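import Summits.KontsevichZagierPeriods.KontsevichZagierPeriods.Theses.SymplecticScissors
import Summits.KontsevichZagierPeriods.KontsevichZagierPeriods.Theorems.SymplecticScissorsTypeAGenerationStubTransposition
import Summits.KontsevichZagierPeriods.KontsevichZagierPeriods.Theorems.SymplecticScissorsTypeAGenerationStubRestrCOne
import Summits.KontsevichZagierPeriods.KontsevichZagierPeriods.Theorems.SymplecticScissorsTypeAGenerationStubRescalePiece
import Summits.KontsevichZagierPeriods.KontsevichZagierPeriods.Theorems.SymplecticScissorsTypeAGenerationStubRoomLemma
import Summits.KontsevichZagierPeriods.KontsevichZagierPeriods.Theorems.TypeAGeneration.Negative.HypothesesAudit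

/-!
# `TypeAGeneration` (stmt-KontsevichZagierPeriods-18392), line `Sketch`: THE ROOM NORMALISATION of
Ayoub's Conjecture 1.1 (registered stub `stub_roomNormalisation`)

The radius-amplification engine of the line `Sketch` (card stokes-compiler) is complete: the six
landed stubs S1–S6 (`SymplecticScissorsTypeAGenerationStub{Transposition, RoomStepCongruence,
SubstRoom(+Aux), RestrCOne(+Aux), RescalePiece, RoomLemma(+Iter)}.lean`) give the ROOM LEMMA —
modulo the `k`-span of the type-(a) elements `∂G/∂zᵢ − G|_{zᵢ=1} + G|_{zᵢ=0}` every
`F ∈ 𝒪_{k-alg}(𝔻̄^∞)` is congruent to an element of polyradius `> R`, for every `R`. This file records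
the resulting NORMALISATION THEOREM of the crux (Ayoub, Ann. of Math. 181 (2015), Conj. 1.1 =
Fresán 2024 Conj. 3.5 = the tree leaf `TypeAGenerationConjecture`):

* `typeAGeneration_of_residual` — the crux follows from its restriction to elements of
  sufficiently large polyradius (`∃ R, …`): `F ↦ P` by the room lemma, `∫ P = ∫ F − ∫ (F − P) = 0`
  because the span integrates to zero (`TypeAGenerationNegative.intC_eq_zero_of_mem_kSpan_relAC`,
  landed by the crux's disprover), the residual puts `P` in the span, and `F = (F − P) + P`;
* `typeAGeneration_iff_residual` / `typeAGeneration_iff_residual_forall` — hence the crux is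
  EQUIVALENT to the crux with as much room as one likes (registered form `stub_roomNormalisation`).

So "not enough polyradius" is never the obstruction to a type-(a) certificate (cf. kit j022569: the
one-stage interpolation certificate of the barrier element `2z/(2−z²) − 1/(2−z)` is inadmissible at
radius `1.05` — after amplification this artefact disappears), while the auxiliary variables the
amplification spends are intrinsic (Ayoub Rem. 1.2; the disprover's
`TypeAGenerationNegative.typeAGeneration_false_sameVariables_withRoom`: room does not buy
same-variable certificates). The residual itself (`stub_residual` of the skeleton
`Cruxes/TypeAGeneration/Lines/Sketch.lean`) stays OPEN, of Grothendieck-period-conjecture strength.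
-/

noncomputable section

-- `Summit.KontsevichZagierPeriods.KontsevichZagierPeriods.…` is the tree's mandated layout (single-conjunct summit).
set_option linter.dupNamespace false

namespace Summit.KontsevichZagierPeriods.KontsevichZagierPeriods.TypeAGenerationLine

open Finsupp MvPowerSeries
open Literature.NumberTheory.Transcendental
open Literature.NumberTheory.Transcendental.AyoubRel
open Summit.KontsevichZagierPeriods.KontsevichZagierPeriods.Theses.SymplecticScissors (TypeAGeneration)
open Summit.KontsevichZagierPeriods.SymplecticScissors.TypeAGenerationNegative
  (intC_eq_zero_of_mem_kSpan_relAC)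

section Glue

variable {k : Type} [Field k] (σ : k →+* ℂ)

/-- Elements of the `k`-span of type (a) have absolutely summable coefficients (each generator
`∂ᵢG − G|₁ + G|₀`, `G` of polyradius `> 1`, does: `summable_norm_coeff_relAC`). [folklore] -/
theorem summable_norm_coeff_of_mem_kSpan_relAC {x : CSeries}
    (hx : x ∈ kSpan σ {x : CSeries | ∃ G ∈ Oan σ, ∃ i : ℕ, x = relAC i G}) :
    Summable fun a : ℕ →₀ ℕ => ‖MvPowerSeries.coeff a x‖ := by
  obtain ⟨n, c, s, hs, rfl⟩ := hx
  have hterm : ∀ j, Summable fun a : ℕ →₀ ℕ => ‖MvPowerSeries.coeff a ((σ (c j)) • s j)‖ := by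
    intro j
    obtain ⟨G, hG, i, hGi⟩ := hs j
    obtain ⟨r, hr, hsum⟩ := hG.2.1
    have h := (StokesGenerationLine.summable_norm_coeff_relAC hr hsum i).mul_left ‖σ (c j)‖
    refine h.congr fun a => ?_
    rw [hGi, MvPowerSeries.coeff_smul, norm_mul]
  refine (summable_sum (s := Finset.univ) fun j _ => hterm j).of_nonneg_of_le
    (fun _ => norm_nonneg _) fun a => ?_
  rw [map_sum]
  exact norm_sum_le _ _

end Glue

/-! ## The crux from its residual with room -/

/-- **The crux follows from the crux WITH ROOM.** If for some radius `R` every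
`F ∈ 𝒪_{k-alg}(𝔻̄^∞)` (`σ` with algebraic image) of polyradius `> R` with `∫ F = 0` lies in the
`k`-span of type (a), then so does every `F ∈ 𝒪_{k-alg}(𝔻̄^∞)` with `∫ F = 0`: by the room lemma
(`stub_roomLemma_of` fed with the landed S1–S5) `F ≡ P` with `P` of polyradius `> R`;
`∫ P = ∫ F − ∫ (F − P) = 0` since the span integrates to zero; the hypothesis puts `P` in the span;
`F = (F − P) + P`. [cite: Ayoub2015, Conj. 1.1] -/
theorem typeAGeneration_of_residual
    (hres : ∃ R : ℝ, ∀ (k : Type) [Field k] [CharZero k] (σ : k →+* ℂ), (∀ c : k, IsAlgebraic ℚ (σ c)) →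
      ∀ F ∈ Oan σ, (∃ r : ℝ, R < r ∧ Summable fun a : ℕ →₀ ℕ => ‖MvPowerSeries.coeff a F‖ * r ^ degree a) →
        intC F = 0 → F ∈ kSpan σ {x : CSeries | ∃ G ∈ Oan σ, ∃ i : ℕ, x = relAC i G}) :
    TypeAGeneration := by
  intro k _ _ σ halg F hF h0
  obtain ⟨R, hres⟩ := hres
  obtain ⟨P, hP, hPr, hFP⟩ := stub_roomLemma_of stub_transposition stub_roomStepCongruence
    stub_substRoom stub_restrCOne stub_rescalePiece k σ R F hF
  have hsF : Summable fun a : ℕ →₀ ℕ => ‖MvPowerSeries.coeff a F‖ := summable_norm_coeff_of_mem_Oan σ hF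
  have hsFP : Summable fun a : ℕ →₀ ℕ => ‖MvPowerSeries.coeff a (F - P)‖ :=
    summable_norm_coeff_of_mem_kSpan_relAC σ hFP
  have hintFP : intC (F - P) = 0 := intC_eq_zero_of_mem_kSpan_relAC σ hFP
  have hP0 : intC P = 0 := by
    have h : intC (F - (F - P)) = intC F - intC (F - P) := intC_sub hsF hsFP
    rw [sub_sub_cancel, h0, hintFP, sub_zero] at h
    exact h
  have hPspan := hres k σ halg P hP hPr hP0
  have h := kSpan_add σ hFP hPspan
  rwa [sub_add_cancel] at h

/-- Conversely (trivially) the crux gives the crux with room, for every `R`. [cite: Ayoub2015, Conj. 1.1] -/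
theorem residual_of_typeAGeneration (h : TypeAGeneration) (R : ℝ) :
    ∀ (k : Type) [Field k] [CharZero k] (σ : k →+* ℂ), (∀ c : k, IsAlgebraic ℚ (σ c)) →
      ∀ F ∈ Oan σ, (∃ r : ℝ, R < r ∧ Summable fun a : ℕ →₀ ℕ => ‖MvPowerSeries.coeff a F‖ * r ^ degree a) →
        intC F = 0 → F ∈ kSpan σ {x : CSeries | ∃ G ∈ Oan σ, ∃ i : ℕ, x = relAC i G} :=
  fun k _ _ σ halg F hF _ h0 => h k σ halg F hF h0

/-- **ROOM NORMALISATION, `∀ R` form**: Ayoub's Conjecture 1.1 is equivalent to its restriction to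
elements of polyradius `> R`, for each `R` separately. [cite: Ayoub2015, Conj. 1.1] -/
theorem typeAGeneration_iff_residual_forall :
    TypeAGeneration ↔
    ∀ R : ℝ, ∀ (k : Type) [Field k] [CharZero k] (σ : k →+* ℂ), (∀ c : k, IsAlgebraic ℚ (σ c)) →
      ∀ F ∈ Oan σ, (∃ r : ℝ, R < r ∧ Summable fun a : ℕ →₀ ℕ => ‖MvPowerSeries.coeff a F‖ * r ^ degree a) →
        intC F = 0 → F ∈ kSpan σ {x : CSeries | ∃ G ∈ Oan σ, ∃ i : ℕ, x = relAC i G} :=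
  ⟨residual_of_typeAGeneration, fun h => typeAGeneration_of_residual ⟨0, h 0⟩⟩

/-- **Registered stub `stub_roomNormalisation` — ROOM NORMALISATION of the crux**: `TypeAGeneration`
(Ayoub 2015 Conj. 1.1 / Fresán 2024 Conj. 3.5) holds iff it holds for the elements of
`𝒪_{k-alg}(𝔻̄^∞)` of SOME sufficiently large polyradius — the residual `stub_residual` of the line
`Sketch` is equivalent to the crux. [cite: Ayoub2015, Conj. 1.1] -/
theorem stub_roomNormalisation :
    TypeAGeneration ↔
    ∃ R : ℝ, ∀ (k : Type) [Field k] [CharZero k] (σ : k →+* ℂ), (∀ c : k, IsAlgebraic ℚ (σ c)) →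
      ∀ F ∈ Oan σ, (∃ r : ℝ, R < r ∧ Summable fun a : ℕ →₀ ℕ => ‖MvPowerSeries.coeff a F‖ * r ^ degree a) →
        intC F = 0 → F ∈ kSpan σ {x : CSeries | ∃ G ∈ Oan σ, ∃ i : ℕ, x = relAC i G} :=
  ⟨fun h => ⟨0, residual_of_typeAGeneration h 0⟩, typeAGeneration_of_residual⟩

end Summit.KontsevichZagierPeriods.KontsevichZagierPeriods.TypeAGenerationLine
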